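import Summits.RiemannHypothesis.RiemannHypothesis.Theorems.GroundBartaPolarPerronFrobeniusEvenSectorBridge
import Summits.RiemannHypothesis.RiemannHypothesis.Theorems.GroundBartaPolarPerronFrobeniusEvenThreshold
import Summits.RiemannHypothesis.RiemannHypothesis.Theorems.OddSectorOddOneSignedWindowsImpliesRH
import HarnessLib

/-!
# Good even-sector windows (route `RiemannHypothesis/GroundBarta`, rung 3 `PolarPerronFrobenius`,
stmt-RiemannHypothesis-18390)

A window `a` is a GOOD EVEN-SECTOR WINDOW if it carries an even-sector bottom state
(`IsWeilEvenGroundState a u`) that is real and `≥ 0` a.e. on `(-a, a)`.  From the even-sector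
deciding theorem (`riemannHypothesis_of_cofinal_evenSectorOneSigned`), the bridge
(`exists_evenSectorOneSigned_of_oneSigned`) and the certified small windows of the full form
(`et_exists_nonneg_isWeilGroundState`, `a ≤ 11/40`):

* `exists_evenSectorOneSigned_of_le_11_40`: every window `0 < a ≤ 11/40` is a good even-sector
  window (RH-free);
* `exists_lastGoodEvenSectorHeight_of_not_riemannHypothesis`: off RH there is a LAST good
  even-sector height `a⋆ ≥ 11/40` (good windows accumulate at `a⋆` from below, none beyond);
* `riemannHypothesis_of_cofinal_oneSigned_either_sector`: if beyond every height SOME parity sector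
  (even: this file's predicate; odd: `IsWeilOddGroundState`, one-signed on `(0, a)`, route
  OddSector) carries a one-signed bottom state, then RH — the two sector floors side by side.
RH-free.  References: Bombieri 2000 §4; Barta 1937.
-/

set_option linter.dupNamespace false

noncomputable section

open Set MeasureTheory Filter Complex
open scoped Real Topology ComplexConjugate

namespace Summit.RiemannHypothesis.RiemannHypothesis.Theorems.PolarPerronFrobenius

open Literature.NumberTheory.LFunctions

/-- **Small windows are good even-sector windows**: for `0 < a ≤ 11/40` some even-sector bottom
state at `a` is real and `≥ 0` a.e. on `(-a, a)` (the certified even kernel threshold of the full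
form, transported by the bridge). [folklore] -/
theorem exists_evenSectorOneSigned_of_le_11_40 {a : ℝ} (ha : 0 < a) (ha' : a ≤ 11 / 40) :
    ∃ u : ℝ → ℂ, IsWeilEvenGroundState a u ∧
      ∀ᵐ t : ℝ, t ∈ Ioo (-a) a → (u t).im = 0 ∧ 0 ≤ (u t).re := by
  obtain ⟨u, hu, hsign⟩ := et_exists_nonneg_isWeilGroundState ha ha'
  exact exists_evenSectorOneSigned_of_oneSigned hu hsign

/-- **Off RH there is a last good even-sector height `a⋆ ≥ 11/40`**: no window beyond `a⋆` carries
a one-signed even-sector bottom state, while good even-sector windows come arbitrarily close to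
`a⋆` from below (`a⋆` = the supremum of the good windows, bounded by
`eventually_forall_not_evenSectorOneSigned_of_not_riemannHypothesis`, at least `11/40` by
`exists_evenSectorOneSigned_of_le_11_40`). [folklore] -/
theorem exists_lastGoodEvenSectorHeight_of_not_riemannHypothesis (hRH : ¬ RiemannHypothesis) :
    ∃ aStar : ℝ, 11 / 40 ≤ aStar ∧
      (∀ a : ℝ, aStar < a → ∀ u : ℝ → ℂ, IsWeilEvenGroundState a u →
        ¬ (∀ᵐ t : ℝ, t ∈ Ioo (-a) a → (u t).im = 0 ∧ 0 ≤ (u t).re)) ∧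
      ∀ ε : ℝ, 0 < ε → ∃ a : ℝ, aStar - ε < a ∧ a ≤ aStar ∧ ∃ u : ℝ → ℂ,
        IsWeilEvenGroundState a u ∧ ∀ᵐ t : ℝ, t ∈ Ioo (-a) a → (u t).im = 0 ∧ 0 ≤ (u t).re := by
  set Good : Set ℝ := {a : ℝ | ∃ u : ℝ → ℂ, IsWeilEvenGroundState a u ∧
    ∀ᵐ t : ℝ, t ∈ Ioo (-a) a → (u t).im = 0 ∧ 0 ≤ (u t).re} with hGood
  obtain ⟨A, hA⟩ := eventually_forall_not_evenSectorOneSigned_of_not_riemannHypothesis hRH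
  have hbdd : BddAbove Good := by
    refine ⟨A, fun a ha => ?_⟩
    by_contra hlt
    push Not at hlt
    obtain ⟨u, hu, hsign⟩ := ha
    exact hA a hlt.le u hu hsign
  have hmem : (11 / 40 : ℝ) ∈ Good :=
    exists_evenSectorOneSigned_of_le_11_40 (by norm_num) le_rfl
  have hne : Good.Nonempty := ⟨_, hmem⟩
  refine ⟨sSup Good, le_csSup hbdd hmem, fun a ha u hu hsign => ?_, fun ε hε => ?_⟩
  · have : a ≤ sSup Good := le_csSup hbdd ⟨u, hu, hsign⟩
    linarith
  · obtain ⟨a, ha, hlt⟩ := exists_lt_of_lt_csSup hne (by linarith : sSup Good - ε < sSup Good)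
    exact ⟨a, hlt, le_csSup hbdd ha, ha⟩

/-- **RH or a last good even-sector height.** [folklore] -/
theorem riemannHypothesis_or_lastGoodEvenSectorHeight :
    RiemannHypothesis ∨ ∃ aStar : ℝ, 11 / 40 ≤ aStar ∧
      ∀ a : ℝ, aStar < a → ∀ u : ℝ → ℂ, IsWeilEvenGroundState a u →
        ¬ (∀ᵐ t : ℝ, t ∈ Ioo (-a) a → (u t).im = 0 ∧ 0 ≤ (u t).re) := by
  by_cases hRH : RiemannHypothesis
  · exact Or.inl hRH
  · obtain ⟨aStar, h1, h2, -⟩ := exists_lastGoodEvenSectorHeight_of_not_riemannHypothesis hRH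
    exact Or.inr ⟨aStar, h1, h2⟩

/-- **The two sector floors side by side**: if beyond every height some window carries EITHER a
one-signed even-sector bottom state (real, `≥ 0` a.e. on `(-a, a)`) OR a one-signed odd-sector
bottom state (real, `≥ 0` a.e. on `(0, a)`, route OddSector), then the Riemann hypothesis holds
(even: `riemannHypothesis_of_cofinal_evenSectorOneSigned`; odd:
`OddSector.eventually_not_goodWindow_of_not_riemannHypothesis`). [folklore] -/
theorem riemannHypothesis_of_cofinal_oneSigned_either_sector
    (hcof : ∀ A : ℝ, ∃ a : ℝ, A ≤ a ∧
      ((∃ u : ℝ → ℂ, IsWeilEvenGroundState a u ∧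
          ∀ᵐ t : ℝ, t ∈ Ioo (-a) a → (u t).im = 0 ∧ 0 ≤ (u t).re) ∨
        (∃ u : ℝ → ℂ, IsWeilOddGroundState a u ∧
          ∀ᵐ t : ℝ, t ∈ Ioo 0 a → (u t).im = 0 ∧ 0 ≤ (u t).re))) :
    RiemannHypothesis := by
  by_contra hRH
  obtain ⟨A₁, hA₁⟩ := eventually_forall_not_evenSectorOneSigned_of_not_riemannHypothesis hRH
  obtain ⟨A₂, hA₂⟩ := OddSector.eventually_not_goodWindow_of_not_riemannHypothesis hRH
  obtain ⟨a, ha, hgood⟩ := hcof (max A₁ A₂)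
  rcases hgood with ⟨u, hu, hsign⟩ | hodd
  · exact hA₁ a (le_trans (le_max_left _ _) ha) u hu hsign
  · exact hA₂ a (le_trans (le_max_right _ _) ha) hodd

end Summit.RiemannHypothesis.RiemannHypothesis.Theorems.PolarPerronFrobenius

end
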